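import Literature.Geometry.Riemannian.AlmostNonnegativeCurvatureSmoothingProofs
import Literature.Geometry.Riemannian.VolumeScaling
import HarnessLib

/-!
# Bamler–Cabezas-Rivas–Wilking 2019, Corollary 3 (1) from Theorem 1 *as printed*: the rescaling step
(topic `Literature/Geometry/Riemannian`; proofs-only companion of
`AlmostNonnegativeCurvatureSmoothing.lean` / `AlmostNonnegativeCurvatureSmoothingProofs.lean`)

R. Bamler, E. Cabezas-Rivas, B. Wilking, *The Ricci flow under almost non-negative curvature
conditions*, Invent. Math. 217 (2019) 95–126 (arXiv:1707.03002).  The named fact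
`BamlerCabezasRivasWilking2019_cor3_nonnegativeCurvatureOperator` (Corollary 3, case (1)) is NOT
discharged here (its printed proof needs Theorem 1 of the paper and Hamilton's compactness theorem
for Ricci flows, neither of which the tree has).  The tree's reduction
`BamlerCabezasRivasWilking2019_cor3_nonnegativeCurvatureOperator_of_ricciFlow_of_compactness`
(`…Proofs.lean`) takes as hypothesis `H1` a flow statement in which the corollary's `diam ≤ D`,
`vol(M) ≥ v₀` already replace the hypothesis "`vol_g(B_g(p, 1)) ≥ v₀` for all `p ∈ M`" of
Theorem 1.  This file proves the sentence of the printed proof that bridges the two (arXiv p. 15: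
"The volume and curvature conditions in (counter_cond) allow us to use Theorems 1 or 2"): the
reduction from **Theorem 1 verbatim, restricted to closed manifolds** —

> **Theorem 1.** Given `n ∈ ℕ` and `v₀ > 0` there exist `C = C(n, v₀) > 0`, `τ = τ(n, v₀) > 0`
> such that: if `(Mⁿ, g)` is complete with bounded curvature [automatic for closed `M`],
> `vol_g(B_g(p, 1)) ≥ v₀` for all `p ∈ M` and `Rm_g ≥ −ε ≥ −1`, then the Ricci flow `g(t)` with
> initial metric `g` exists until time `τ` and `Rm_{g(t)} ≥ −Cε`, `|Rm_{g(t)}| ≤ C/t` for all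
> `t ∈ (0, τ]`

— by **parabolic rescaling** (p. 3: the bounds "hold for any metric after rescaling"; Topping 2006,
§1.2.3): for `(M, g)` closed with `diam_g(M) ≤ D` put `g' = (2D)⁻² g`; then `diam_{g'} ≤ 1/2`, so
every unit `g'`-ball is all of `M` (`ball_constSmul_eq_univ_of_riemEDist_le`) and
`vol_{g'}(B_{g'}(p, 1)) = vol_{g'}(M) = (2D)^{-n} vol_g(M) ≥ (2D)^{-n} v₀`
(`ofReal_mul_le_riemVolume_constSmul`, from `vol_constSmul` of `VolumeScaling.lean`), while
`Rm_{g'} ≥ −(2D)² ε` (`HasCurvatureOperatorGe.constSmul`), which is `≥ −1` once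
`ε ≤ (2D)⁻²`.  Theorem 1 gives the flow `g'(s)`, `s ∈ [0, τ]`; the parabolically rescaled flow
`g(t) = (2D)² g'((2D)⁻² t)` (`IsRicciFlow.parabolicRescale`, `RicciFlowScaling.lean`) starts at
`g`, lives on `[0, (2D)² τ]`, has `Rm_{g(t)} ≥ −Cε` and — the bound `|Rm(φ, φ)| ≤ (C/t) |φ|²`
being scale invariant (`abs_curvatureOperatorForm_constSmul_le`) — `|Rm_{g(t)}| ≤ C/t`.  Along the
contradiction sequence `Rm_{gᵢ} ≥ −1/(i+1)` of the printed proof only the tail `i + 1 ≥ (2D)²`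
is rescaled into the range `ε ≤ 1` of Theorem 1; dropping finitely many terms is harmless in the
sequential form of the corollary (`…_iff_seq`, `…_of_limit`).  Result:
`BamlerCabezasRivasWilking2019_cor3_nonnegativeCurvatureOperator_of_theorem1_of_compactness` —
Corollary 3 (1) follows from Theorem 1 (closed case, `H1`) and the compactness step `H2` of
`…_of_ricciFlow_of_compactness` (Hamilton's compactness theorem with the passage of `Rm ≥ −C/(i+1)`
to the limit and the diffeomorphisms `M_∞ ≅ Mᵢ`; unchanged).  Everything here is proved; no facts
are vended; `H1`, `H2` are hypotheses of a theorem, not named facts.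

## References

* R. H. Bamler, E. Cabezas-Rivas, B. Wilking, Invent. Math. 217 (2019) 95–126, arXiv:1707.03002:
  Theorem 1 (p. 3), proof of Corollary 3 (p. 15). [`BamlerCabezasrivasWilking2019`]
* P. Topping, *Lectures on the Ricci flow* (2006), §1.2.3 (parabolic rescaling). [`Topping2006`]
-/

noncomputable section

open Bundle Set MeasureTheory
open scoped Manifold ContDiff Topology BigOperators ENNReal

namespace Literature.Geometry.Riemannian

open Literature.Geometry.Lorentzian (PseudoRiemannianMetric)
open Literature.Geometry.Lorentzian.PseudoRiemannianMetric

/-! ### Scaling lemmas (all elementary) -/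

section Scaling

variable {E : Type*} [NormedAddCommGroup E] [NormedSpace ℝ E] {H : Type*} [TopologicalSpace H]
  {I : ModelWithCorners ℝ E H} {M : Type*} [TopologicalSpace M] [ChartedSpace H M]
  [IsManifold I ∞ M] {n : ℕ∞ω}

/-- **Small diameter ⇒ unit balls are everything after shrinking**: if `d_g(x, y) ≤ D` for all
`x, y` and `√c · D < 1`, then every unit ball of `c g` is all of `M` (`d_{c g} = √c d_g`,
`riemEDist_constSmul`). [cite: BamlerCabezasrivasWilking2019, proof of Corollary 3 (p. 15)] -/
theorem ball_constSmul_eq_univ_of_riemEDist_le [FiniteDimensional ℝ E]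
    (g : PseudoRiemannianMetric I n E (TangentSpace I : M → Type _)) {D : ℝ}
    (hdiam : ∀ x y : M, g.riemEDist x y ≤ ENNReal.ofReal D) {c : ℝ} (hc : 0 < c)
    (hcD : Real.sqrt c * D < 1) (p : M) :
    (g.constSmul c hc.ne').ball p 1 = univ := by
  refine eq_univ_of_forall fun y ↦ ?_
  rw [PseudoRiemannianMetric.mem_ball, riemEDist_constSmul g hc]
  calc ENNReal.ofReal (Real.sqrt c) * g.riemEDist p y
      ≤ ENNReal.ofReal (Real.sqrt c) * ENNReal.ofReal D := by gcongr; exact hdiam p y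
    _ = ENNReal.ofReal (Real.sqrt c * D) := (ENNReal.ofReal_mul (Real.sqrt_nonneg c)).symm
    _ < 1 := ENNReal.ofReal_lt_one.2 hcD

/-- **Volume lower bounds under rescaling**: `vol_g(s) ≥ v₀ ⇒ vol_{c g}(s) ≥ (√c)^{dim M} v₀`
(`vol_{c g} = (√c)^{dim M} vol_g`, `vol_constSmul`). [cite: BamlerCabezasrivasWilking2019, proof of Corollary 3 (p. 15)] -/
theorem ofReal_mul_le_riemVolume_constSmul [FiniteDimensional ℝ E] [T3Space M]
    [MeasurableSpace M] [BorelSpace M]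
    (g : PseudoRiemannianMetric I n E (TangentSpace I : M → Type _)) {c : ℝ} (hc : 0 < c)
    {v₀ : ℝ} {s : Set M} (hvol : ENNReal.ofReal v₀ ≤ g.riemVolume s) :
    ENNReal.ofReal (Real.sqrt c ^ Module.finrank ℝ E * v₀) ≤ (g.constSmul c hc.ne').riemVolume s := by
  have h : (g.constSmul c hc.ne').riemVolume s =
      ENNReal.ofReal (Real.sqrt c) ^ Module.finrank ℝ E * g.riemVolume s :=
    vol_constSmul g hc s
  rw [h, ENNReal.ofReal_mul (pow_nonneg (Real.sqrt_nonneg c) _),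
    ENNReal.ofReal_pow (Real.sqrt_nonneg c)]
  gcongr

/-- **`|Rm(φ, φ)| ≤ K |φ|²` under rescaling**: for a fixed connection, `Rm_{c g}(φ, φ) = c Rm_g(φ, φ)`
and `|φ|²_{c g} = c² |φ|²_g`, so the bound `|Rm_g(φ, φ)| ≤ K |φ|²_g` becomes
`|Rm_{c g}(φ, φ)| ≤ (K / c) |φ|²_{c g}` — the scale invariance of "`|Rm_{g(t)}| ≤ C/t`" under
`g(t) ↦ c g(t/c)`. [cite: Topping2006, §1.2.3] -/
theorem abs_curvatureOperatorForm_constSmul_le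
    {g : PseudoRiemannianMetric I n E (TangentSpace I : M → Type _)}
    {cov : CovariantDerivative I E (TangentSpace I : M → Type _)} {c K : ℝ} (hc : 0 < c) {x : M}
    {m : ℕ} {X Y : Fin m → TangentSpace I x}
    (h : |g.curvatureOperatorForm cov x X Y| ≤ K * g.bivectorNormSq x X Y) :
    |(g.constSmul c hc.ne').curvatureOperatorForm cov x X Y| ≤
      K / c * (g.constSmul c hc.ne').bivectorNormSq x X Y := by
  rw [curvatureOperatorForm_constSmul, bivectorNormSq_constSmul, abs_mul, abs_of_pos hc]
  have hK : K / c * (c ^ 2 * g.bivectorNormSq x X Y) = c * (K * g.bivectorNormSq x X Y) := by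
    field_simp
  rw [hK]
  exact mul_le_mul_of_nonneg_left h hc.le

/-- Undoing a shrinking: `c • (c⁻¹ • g) = g`. [folklore] -/
theorem constSmul_inv_constSmul' (g : PseudoRiemannianMetric I n E (TangentSpace I : M → Type _))
    {c : ℝ} (hc : c ≠ 0) (h₁ : c⁻¹ ≠ 0) (h₂ : c ≠ 0) :
    (g.constSmul c⁻¹ h₁).constSmul c h₂ = g := by
  ext b v w
  simp [mul_inv_cancel_left₀ hc]

end Scaling

/-! ### Corollary 3 (1) from Theorem 1 (closed manifolds, as printed) and the compactness step -/

/-- **Corollary 3 (1) from Theorem 1 as printed (closed case) and the compactness step.**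
`H1` is Theorem 1 of Bamler–Cabezas-Rivas–Wilking (p. 3) for CLOSED manifolds ("complete with
bounded curvature" is then automatic): given `n` and `v₀ > 0` there are `τ, C > 0` such that for a
closed Riemannian `(Mⁿ, g₀)` with `vol_{g₀}(B_{g₀}(p, 1)) ≥ v₀` for all `p` and `Rm_{g₀} ≥ −ε`,
`0 < ε ≤ 1`, the Ricci flow from `g₀` exists on `[0, τ]` (a `IsRicciFlow` family of Riemannian
metrics, `RicciFlow.lean`) with `Rm_{g(t)} ≥ −Cε` and `|Rm_{g(t)}(φ, φ)| ≤ (C/t) |φ|²` for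
`t ∈ (0, τ]`.  `H2` is the compactness step exactly as in
`BamlerCabezasRivasWilking2019_cor3_nonnegativeCurvatureOperator_of_ricciFlow_of_compactness`
(p. 15: Hamilton's compactness theorem, "the curvature condition … passes to the limit", "the
uniform diameter bound … ensures that `M_∞` is diffeomorphic to `Mᵢ` for all `i` large enough").
Proof: along a sequence `(Mᵢ, gᵢ)` with `diam ≤ D`, `vol ≥ v₀`, `Rm ≥ −1/(i+1)` drop the terms with
`i + 1 < (2D)²`, shrink `gᵢ ↦ (2D)⁻² gᵢ` (unit balls become `Mᵢ`, `vol ≥ (2D)⁻ⁿ v₀`,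
`Rm ≥ −(2D)²/(i+1) ≥ −1`), apply `H1`, rescale the flows back parabolically (`Rm ≥ −C/(i+1)`,
`|Rm| ≤ C/t` on `(0, (2D)² τ]`), apply `H2` to the shifted sequence and conclude by `…_of_limit`.
[cite: BamlerCabezasrivasWilking2019, Theorem 1 (p. 3) and proof of Corollary 3 (p. 15)]
[cite: Topping2006, §1.2.3] -/
theorem BamlerCabezasRivasWilking2019_cor3_nonnegativeCurvatureOperator_of_theorem1_of_compactness
    (H1 : ∀ (k : ℕ) (v₀ : ℝ), 0 < v₀ → ∃ τ C : ℝ, 0 < τ ∧ 0 < C ∧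
      ∀ (M : Type) [TopologicalSpace M] [T2Space M] [SecondCountableTopology M] [CompactSpace M]
        [MeasurableSpace M] [BorelSpace M]
        [ChartedSpace (EuclideanSpace ℝ (Fin k)) M] [IsManifold (𝓡 k) ∞ M]
        (g₀ : PseudoRiemannianMetric (𝓡 k) ∞ (EuclideanSpace ℝ (Fin k))
          (TangentSpace (𝓡 k) : M → Type _)),
        g₀.IsRiemannian →
        (∀ p : M, ENNReal.ofReal v₀ ≤ g₀.riemVolume (g₀.ball p 1)) →
        ∀ ε : ℝ, 0 < ε → ε ≤ 1 → g₀.HasCurvatureOperatorGe ε →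
          ∃ (g : ℝ → PseudoRiemannianMetric (𝓡 k) ∞ (EuclideanSpace ℝ (Fin k))
              (TangentSpace (𝓡 k) : M → Type _))
            (cov : ℝ → CovariantDerivative (𝓡 k) (EuclideanSpace ℝ (Fin k))
              (TangentSpace (𝓡 k) : M → Type _)),
            g 0 = g₀ ∧ IsRicciFlow g cov (Set.Icc 0 τ) ∧
            ∀ t ∈ Set.Ioc 0 τ, (g t).IsRiemannian ∧ (g t).HasCurvatureOperatorGe (C * ε) ∧
              ∀ (x : M) (m : ℕ) (X Y : Fin m → TangentSpace (𝓡 k) x),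
                |(g t).curvatureOperatorForm (cov t) x X Y| ≤ C / t * (g t).bivectorNormSq x X Y)
    (H2 : ∀ (k : ℕ) (D v₀ τ C : ℝ), 0 < D → 0 < v₀ → 0 < τ → 0 < C →
      ∀ (M : ℕ → Type) [∀ i, TopologicalSpace (M i)] [∀ i, T2Space (M i)]
        [∀ i, SecondCountableTopology (M i)] [∀ i, CompactSpace (M i)]
        [∀ i, MeasurableSpace (M i)] [∀ i, BorelSpace (M i)]
        [∀ i, ChartedSpace (EuclideanSpace ℝ (Fin k)) (M i)] [∀ i, IsManifold (𝓡 k) ∞ (M i)]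
        (g₀ : ∀ i, PseudoRiemannianMetric (𝓡 k) ∞ (EuclideanSpace ℝ (Fin k))
          (TangentSpace (𝓡 k) : M i → Type _)),
        (∀ i, (g₀ i).IsRiemannian) →
        (∀ i (x y : M i), (g₀ i).riemEDist x y ≤ ENNReal.ofReal D) →
        (∀ i, ENNReal.ofReal v₀ ≤ (g₀ i).riemVolume Set.univ) →
        (∀ i, (g₀ i).HasCurvatureOperatorGe (1 / ((i : ℝ) + 1))) →
        ∀ (g : ∀ i, ℝ → PseudoRiemannianMetric (𝓡 k) ∞ (EuclideanSpace ℝ (Fin k))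
            (TangentSpace (𝓡 k) : M i → Type _))
          (cov : ∀ i, ℝ → CovariantDerivative (𝓡 k) (EuclideanSpace ℝ (Fin k))
            (TangentSpace (𝓡 k) : M i → Type _)),
          (∀ i, g i 0 = g₀ i) → (∀ i, IsRicciFlow (g i) (cov i) (Set.Icc 0 τ)) →
          (∀ i, ∀ t ∈ Set.Ioc 0 τ, (g i t).IsRiemannian ∧
            (g i t).HasCurvatureOperatorGe (C * (1 / ((i : ℝ) + 1))) ∧
            ∀ (x : M i) (m : ℕ) (X Y : Fin m → TangentSpace (𝓡 k) x),
              |(g i t).curvatureOperatorForm (cov i t) x X Y| ≤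
                C / t * (g i t).bivectorNormSq x X Y) →
            ∃ (M' : Type) (_ : TopologicalSpace M') (_ : ChartedSpace (EuclideanSpace ℝ (Fin k)) M')
              (_ : IsManifold (𝓡 k) ∞ M')
              (g' : PseudoRiemannianMetric (𝓡 k) ∞ (EuclideanSpace ℝ (Fin k))
                (TangentSpace (𝓡 k) : M' → Type _)),
              g'.IsRiemannian ∧ g'.HasNonnegativeCurvatureOperator ∧
                ∃ i, Nonempty (M i ≃ₘ^∞⟮𝓡 k, 𝓡 k⟯ M')) :
    BamlerCabezasRivasWilking2019_cor3_nonnegativeCurvatureOperator := by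
  refine BamlerCabezasRivasWilking2019_cor3_nonnegativeCurvatureOperator_of_limit
    fun k D v₀ hD hv₀ M _ _ _ _ _ _ _ _ g₀ hg₀ hdiam hvol hRm ↦ ?_
  /- The scales: `c = (2D)²` (blow-up factor), `c⁻¹ = σ²` with `σ = (2D)⁻¹` (shrinking factor,
  `√(c⁻¹) = σ`), the shrunk volume bound `v₀' = σ^k v₀`, and the shift `N ≥ c`. -/
  set σ : ℝ := (2 * D)⁻¹ with hσ
  have h2D : 0 < 2 * D := by positivity
  have hσpos : 0 < σ := inv_pos.2 h2D
  set c : ℝ := (2 * D) ^ 2 with hc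
  have hcpos : 0 < c := by positivity
  have hcinv : c⁻¹ = σ ^ 2 := by rw [hσ, hc, inv_pow]
  have hcipos : 0 < c⁻¹ := inv_pos.2 hcpos
  have hsqrt : Real.sqrt c⁻¹ = σ := by rw [hcinv, Real.sqrt_sq hσpos.le]
  have hσD : Real.sqrt c⁻¹ * D < 1 := by
    rw [hsqrt, hσ]
    have : (2 * D)⁻¹ * D = 1 / 2 := by field_simp
    rw [this]
    norm_num
  have hfin : Module.finrank ℝ (EuclideanSpace ℝ (Fin k)) = k := by simp
  set v₀' : ℝ := σ ^ k * v₀ with hv₀'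
  have hv₀' : 0 < v₀' := by positivity
  obtain ⟨τ, C, hτ, hC, hflow⟩ := H1 k v₀' hv₀'
  obtain ⟨N, hN⟩ := exists_nat_ge c
  -- the `ε` of the shrunk `i`-th metric, `i = N + j`: `c / (N + j + 1) ∈ (0, 1]`
  have hεpos : ∀ j : ℕ, (0 : ℝ) < 1 / (((N + j : ℕ) : ℝ) + 1) := fun j ↦ by positivity
  have hεle : ∀ j : ℕ, 1 / (((N + j : ℕ) : ℝ) + 1) / c⁻¹ ≤ 1 := fun j ↦ by
    rw [div_inv_eq_mul, div_mul_eq_mul_div, one_mul, div_le_one (by positivity)]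
    push_cast
    linarith [(Nat.cast_nonneg j : (0 : ℝ) ≤ j)]
  have hεpos' : ∀ j : ℕ, (0 : ℝ) < 1 / (((N + j : ℕ) : ℝ) + 1) / c⁻¹ := fun j ↦
    div_pos (hεpos j) hcipos
  -- the shrunk metrics satisfy the hypotheses of Theorem 1
  have hshrR : ∀ j, ((g₀ (N + j)).constSmul c⁻¹ hcipos.ne').IsRiemannian := fun j ↦
    (hg₀ (N + j)).constSmul hcipos
  have hshrV : ∀ j (p : M (N + j)), ENNReal.ofReal v₀' ≤
      ((g₀ (N + j)).constSmul c⁻¹ hcipos.ne').riemVolume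
        (((g₀ (N + j)).constSmul c⁻¹ hcipos.ne').ball p 1) := fun j p ↦ by
    rw [ball_constSmul_eq_univ_of_riemEDist_le (g₀ (N + j)) (hdiam (N + j)) hcipos hσD p]
    have h := ofReal_mul_le_riemVolume_constSmul (g₀ (N + j)) hcipos (hvol (N + j))
    rwa [hfin, hsqrt] at h
  have hshrRm : ∀ j, ((g₀ (N + j)).constSmul c⁻¹ hcipos.ne').HasCurvatureOperatorGe
      (1 / (((N + j : ℕ) : ℝ) + 1) / c⁻¹) := fun j ↦ (hRm (N + j)).constSmul hcipos
  -- Theorem 1 on the shrunk metrics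
  choose g' cov' hg'0 hRF' hbounds' using fun j : ℕ ↦
    hflow (M (N + j)) ((g₀ (N + j)).constSmul c⁻¹ hcipos.ne') (hshrR j) (hshrV j)
      (1 / (((N + j : ℕ) : ℝ) + 1) / c⁻¹) (hεpos' j) (hεle j) (hshrRm j)
  -- rescale the flows back: `g j t = c • g' j (c⁻¹ t)` on `[0, c τ]`
  set g : ∀ j : ℕ, ℝ → PseudoRiemannianMetric (𝓡 k) ∞ (EuclideanSpace ℝ (Fin k))
      (TangentSpace (𝓡 k) : M (N + j) → Type _) :=
    fun j t ↦ (g' j (c⁻¹ * t)).constSmul c hcpos.ne' with hg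
  set cov : ∀ j : ℕ, ℝ → CovariantDerivative (𝓡 k) (EuclideanSpace ℝ (Fin k))
      (TangentSpace (𝓡 k) : M (N + j) → Type _) := fun j t ↦ cov' j (c⁻¹ * t) with hcov
  have hset : (fun t : ℝ ↦ c⁻¹ * t) ⁻¹' Set.Icc 0 τ = Set.Icc 0 (τ * c) := by
    rw [Set.preimage_const_mul_Icc₀ 0 τ hcipos, zero_div, div_inv_eq_mul]
  have hτc : 0 < τ * c := mul_pos hτ hcpos
  have hg0 : ∀ j, g j 0 = g₀ (N + j) := fun j ↦ by
    simp only [hg, mul_zero, hg'0]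
    exact constSmul_inv_constSmul' _ hcpos.ne' _ _
  have hRF : ∀ j, IsRicciFlow (g j) (cov j) (Set.Icc 0 (τ * c)) := fun j ↦ by
    have h := (hRF' j).parabolicRescale hcpos
    rwa [hset] at h
  have hbounds : ∀ j, ∀ t ∈ Set.Ioc 0 (τ * c), (g j t).IsRiemannian ∧
      (g j t).HasCurvatureOperatorGe (C * (1 / ((j : ℝ) + 1))) ∧
      ∀ (x : M (N + j)) (m : ℕ) (X Y : Fin m → TangentSpace (𝓡 k) x),
        |(g j t).curvatureOperatorForm (cov j t) x X Y| ≤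
          C / t * (g j t).bivectorNormSq x X Y := by
    intro j t ht
    have hs : c⁻¹ * t ∈ Set.Ioc 0 τ := by
      refine ⟨mul_pos hcipos ht.1, ?_⟩
      calc c⁻¹ * t ≤ c⁻¹ * (τ * c) := by gcongr; exact ht.2
        _ = τ := by field_simp
    obtain ⟨hR, hGe, hAbs⟩ := hbounds' j (c⁻¹ * t) hs
    refine ⟨hR.constSmul hcpos, ?_, fun x m X Y ↦ ?_⟩
    · -- `Rm ≥ −C ε'/c = −C/(N+j+1) ≥ −C/(j+1)`
      have h := hGe.constSmul hcpos
      have heq : C * (1 / (((N + j : ℕ) : ℝ) + 1) / c⁻¹) / c = C * (1 / (((N + j : ℕ) : ℝ) + 1)) := by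
        field_simp
      rw [heq] at h
      refine h.mono (hR.constSmul hcpos) ?_
      gcongr
      linarith [(Nat.cast_nonneg N : (0 : ℝ) ≤ N)]
    · have h := abs_curvatureOperatorForm_constSmul_le hcpos (hAbs x m X Y)
      have heq : C / (c⁻¹ * t) / c = C / t := by
        field_simp
      rwa [heq] at h
  -- the compactness step on the shifted sequence
  obtain ⟨M', iT, iCh, iMan, g'', hg'', hN', i, hΦ⟩ :=
    H2 k D v₀ (τ * c) C hD hv₀ hτc hC (fun j ↦ M (N + j)) (fun j ↦ g₀ (N + j))
      (fun j ↦ hg₀ (N + j)) (fun j ↦ hdiam (N + j)) (fun j ↦ hvol (N + j))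
      (fun j ↦ (hRm (N + j)).mono (hg₀ (N + j)) (by
        gcongr
        linarith [(Nat.cast_nonneg N : (0 : ℝ) ≤ N)]))
      g cov hg0 hRF hbounds
  exact ⟨M', iT, iCh, iMan, g'', hg'', hN', N + i, hΦ⟩

end Literature.Geometry.Riemannian

end
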